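import Mathlib
import HarnessLib
import HarnessLib.Audit
import Summits.BirchSwinnertonDyer.Statement
import Summits.BirchSwinnertonDyer.BirchSwinnertonDyer.Theorems.RamifiedSevenEllipticUnitsMechanismBridgeZp
import Summits.BirchSwinnertonDyer.BirchSwinnertonDyer.Theorems.CMRungInputs
import HarnessLib.Audit.Status.Attr

/-!
Route: RamifiedSevenEllipticUnits

It suffices to show, for every global minimal model `W` of a curve in the class 𝒞₇
(`X12.ClassCSeven`: CM by `ℚ(√−7)`,
analytic rank one, good ordinary at `2`, every bad prime `q ≠ 7` split in `K` — an INFINITE family: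
the quadratic twists
of `49a1` / `49a2` meeting those local conditions; its 26 members of conductor `< 5·10⁵` are the
cell's certified census
— Route U 25/26 per-member BSD₇ assemblies modulo print binders + CERTIFIED-DATUM W-79A; CENSUS26 —
which decides no instance
of the leaf beyond those members), the three O11 statements AT THE RAMIFIED PRIME `p = 7` of
`Rank1Residual/X12/O11/RamifiedStrictDescent.lean`: (R-EU) the elliptic-unit index
law `EllipticUnitIndexSeven` (Rubin's two-variable main conjecture over `K` read at the ramified
prime as
`ord_𝔭 [units : elliptic units]_χ = ord_𝔭 (L^alg · ∏ c_v · #Ш-free part)`; since rev 13 SPLIT into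
the cite-level IMC identity
`EllipticUnitIMCSeven` (support, in print) and the ATTACKED value law `EllipticUnitValueSeven`
(crux: Perrin-Riou's law for the
bottom elliptic-unit class at the ramified prime, relative to the IMC identity — the one statement
not in print), (R-tors) strict `7`-torsion
vanishing `StrictTorsionSeven`, and (R-ctrl) strict anticyclotomic control `StrictControlSeven`.
This route
closes the registered RUNG LEAF K7r `X12.CMRamifiedSeven` (D-0061: BSD(E, p) for every `E ∈ 𝒞₇` and
EVERY prime `p`), not the summit: `p ≠ 7` is already a tree theorem (`X12/CMSevenAwayFromSeven`).
Lean: `∀ (W : WeierstrassCurve ℚ) [W.IsElliptic] [W.IsGloballyMinimal] [Fact (Nat.Prime 7)],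
Summit.BirchSwinnertonDyer.Rank1Residual.X12.ClassCSeven W →
Summit.BirchSwinnertonDyer.Rank1Residual.X12.O11.RamifiedCMEllipticUnitIndexAt W 7 ∧
Summit.BirchSwinnertonDyer.Rank1Residual.X12.O11.RamifiedCMStrictTorsionAt W 7 ∧
Summit.BirchSwinnertonDyer.Rank1Residual.X12.O11.RamifiedCMStrictControlAt W 7`

CLOSES_TARGET: closes rung K7r of BirchSwinnertonDyer: Summit.BirchSwinnertonDyer.Rank1Residual.X12.CMRamifiedSeven (D-0061; not the summit Statement) — the deciding theorem of this route concludes that registered leaf instead of the Statement decl `BirchSwinnertonDyer` (class rung: servable and labelled, never counted as concluding the summit Statement).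

Rationale: WHY THIS LINE. At a prime `p` ramified in the CM field no `p`-adic Gross–Zagier / BDP formula is in
print (BurungaleKobayashiNakamuraOta2026
Thm 1.2 / §1.4 prove the anticyclotomic main conjecture at ramified `p` but give no leading-term
formula; LiLiuTian2024,
Kobayashi2013, LiTianYanZhu2025 all exclude `p | d_K`), so the height side (barrier
`AnticyclotomicHeightDegeneracy`) is
avoided altogether: the line imports Rubin's Euler system of ELLIPTIC UNITS (Rubin1991MainConj,
two-variable main
conjecture incl. `p | #𝒪_K^×`-free ramified case for `p = 7 ∤ 2·3`) and reads BSD(E,7) off an INDEX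
formula plus two
finite-level control statements, exactly the three hypotheses of the LANDED consumer
`X12.ClassCSeven.forall_bsdp_of_O11_halves` (p397188) — Iwasawa theory of `ℤ_7`-extensions of
`ℚ(√−7)` in which `7`
is totally ramified (Rubin1987LocalUnits for the local units, AgboolaHoward2006 / Castella2018-type
anticyclotomic
control). What it does that no open route does: every listed BSD route (KatoTransfer, SelmerRank,
PAdicOrderV2, …) works
at good ordinary / supersingular `p`; the negatives index has no statement at a ramified CM prime.

RANKED CRUXES. #2 EllipticUnitIndexSeven (crux) — (R-EU)@7 on 𝒞₇ — for every global minimal `W` in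
𝒞₇, the ramified-prime elliptic-unit index law `O11.RamifiedCMEllipticUnitIndexAt W 7` (Rubin's main
conjecture over `K = ℚ(√−7)` specialised to the character of `W` at the prime `𝔭 | 7`, as typed in
`X12/O11/RamifiedStrictDescent.lean`). [difficulty: XL] (why it might fail: Rubin's two-variable
main conjecture is proved for `p ∤ #𝒪_K^× · [K:ℚ]`-type hypotheses; at `p = 7 = −d_K` the
μ-invariant/local-units input (Rubin1987LocalUnits) is the totally ramified case, where the
index-to-L-value specialisation can lose a power of 7 (root-of-unity / different factor).)
[Rubin1991MainConj, Rubin1987LocalUnits, BurungaleKobayashiNakamuraOta2026, arXiv:2608.06879]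
#3 StrictTorsionSeven (crux) — (R-tors)@7 on 𝒞₇ — strict `7`-torsion vanishing
`O11.RamifiedCMStrictTorsionAt W 7` for every global minimal `W` in 𝒞₇ (no `7`-torsion in the
relevant strict Selmer module over the anticyclotomic tower at the ramified prime). [difficulty: L]
(why it might fail: at the ramified prime the formal group of `W/ℚ_7` has height-one reduction only
after the totally ramified twist; `E(K_𝔭)[7] = 0` holds for 𝒞₇ members but the STRICT module over
the tower may acquire 7-torsion from the norm-incompatibility of local points (no Perrin-Riou basis
at ramified p).) [AgboolaHoward2006, Rubin1987LocalUnits, BurungaleKobayashiOta2021,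
arXiv:2508.17776]
#4 StrictControlSeven (crux) — (R-ctrl)@7 on 𝒞₇ — strict anticyclotomic control
`O11.RamifiedCMStrictControlAt W 7` for every global minimal `W` in 𝒞₇ (Mazur-type control for the
strict Selmer group along the anticyclotomic `ℤ_7`-extension of `ℚ(√−7)`, finite bounded kernel and
cokernel at level 0). [difficulty: L] (why it might fail: control theorems at primes where the
extension is totally ramified AND the curve has additive reduction need the local condition to be
cofinitely generated with controlled universal norms; for additive reduction at 7 the universal-norm
subgroup can be of infinite index (Greenberg LNM1716 §3 caveat).) [GreenbergLNM1716,
AgboolaHoward2006, Castella2018, BurungaleKobayashiNakamuraOta2026]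
#9 FrameDataSeven (support) — frame data at 7 for each `W ∈ 𝒞₇` — the CM field `K` with the prime `𝔭
∋ 7`, an isogenous global-minimal twin `W'` with its frame `O11.IsFrame W 7 K 𝔭 W' C`, an
anticyclotomic `ℤ_7`-extension with a topological generator, and for `W` and `W'` a generator `P` of
`E(ℚ)/tors` with its exact `7`-divisibility level `n` in `E(ℚ_7)` and `E(ℚ_7)[7] = 0`; provable now
member-by-member from the class list (26 curves) — bookkeeping, not a crux. [difficulty:
provable-now] [Miller2011LMS, SilvermanATAEC1994, BurungaleKobayashiNakamuraOta2026]
#9 PublishedFactsSeven (support) — the published named facts the consumer takes as hypotheses, as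
ONE conjunction: Rubin/Coates–Wiles rank-0 CM BSD triple, entire continuation of `L(E,s)`, LLT24 Thm
1.1, Kob13 Cor 1.4, LTYZ25 Thm 1.1 (BSD(E,p) for CM rank one at the NON-ramified primes),
Gross–Zagier I.7.3, GZK rank ≤ 1 ⇒ rank = analytic rank and Ш finite, Cassels isogeny invariance of
the BSD quotient — each a cite-tagged `def … : Prop` of Literature, discharged by `(h : X)`.
[difficulty: provable-now] [LiLiuTian2024, Kobayashi2013, LiTianYanZhu2025, GrossZagier1986,
Cassels1965ArithmeticVIII, BurungaleFlach2024]

TWO-LAYER PLAN. EllipticUnitIndexSeven ⇐ (Rubin two-variable main conjecture for `K = ℚ(√−7)`, `p =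
7`, as a Literature named fact) → (specialisation
to the Hecke character of `W` at `𝔭`: the index of elliptic units in local units at the ramified
prime equals the 𝔭-adic valuation of
`L(ψ̄,1)/Ω` up to a 7-unit) → EllipticUnitIndexSeven. StrictControlSeven ⇐ (control for the relaxed
Selmer group, Greenberg) →
(comparison relaxed/strict at the unique ramified prime: finite index given `E(ℚ_7)[7] = 0` from
FrameDataSeven) → StrictControlSeven.

KILL CRITERIA. A refutation of EllipticUnitIndexSeven on ONE member of 𝒞₇ (e.g. `49a1` twisted,
where Route-U certificates give BSD₇ independently:
a mismatch between the certified `#Ш[7^∞]` and the index side) closes the route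
`refuted:EllipticUnitIndexSeven`; a counterexample to
StrictControlSeven (infinite universal-norm index at 7 for additive reduction) forces a pivot to the
relaxed-Selmer formulation (new
item, same leaf). If Route-U (ram, `X12/O11/RouteU*.lean`) certifies BSD₇ for all 26 members
directly, the leaf closes without this
route (moot, `superseded`).

NOT DECOMPOSED YET. The passage Rubin-main-conjecture ⇒ (R-EU) at the ramified prime (the
different/root-of-unity factor at `𝔭 | 7`), and the
relaxed-vs-strict comparison inside (R-ctrl); both are layer-2 children once a prover has the frame
data of one member in hand.
Member-by-member frame data (26 curves) is support, proved on demand.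

CHEAPEST FALSIFIER. Member `5929e1` (= `49a1^(−11)`-type unit-case member): Route-U has CERTIFIED
`BSD(5929e1, 7)` in the tree (ram p404110
`RouteUSeven5929`, p404516 `RouteUPrimeMember`: `#Ш[7^∞] = 1`, Tamagawa and index by decide+kernel).
Evaluate the (R-EU) index side
for this member (elliptic-unit index at 𝔭 = (√−7) via the Bernoulli–Hurwitz number, BG85 (8.3)): if
its 7-adic valuation is not
`0` the crux EllipticUnitIndexSeven is false as typed. Not run by me (needs the O11 index definition
unfolded; a refuter's first job).

NUMBERS. 𝒞₇: 26 isogeny classes, conductor `49·m²`, `N < 500000` (Miller2011LMS-style class list,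
tree `X12.ClassCSeven`); Route-U census
(TARGET §5): per-member BSD₇ instantiated 1/26 (5929e1), generic prime-member theorem landed (q ∈
{11,23,43,67,71}), full-BSD
corollaries 0/26. `p = 7`: `E(ℚ_7)[7] = 0` for all members (additive reduction, `c_7 ∈ {1,2,4}`).

DEFINITION REQUESTS. None: `O11.RamifiedCMEllipticUnitIndexAt`, `RamifiedCMStrictTorsionAt`,
`RamifiedCMStrictControlAt`, `IsFrame` are tree
definitions (`X12/O11/RamifiedStrictDescent.lean`, p396xxx series); the leaf `X12.CMRamifiedSeven`
is p405122.

Novelty: Searches (2026-08-25): lit search "anticyclotomic ramified primes CM elliptic units main conjecture"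
(corpus kw: 2 docs — paper:arxiv-2608.06879 pp 1,41,43; paper:arxiv-2508.17776 p59; remote: arxiv 2,
zbmath 2, crossref 6, openalex/s2 HTTP 429); lit search --hybrid "BSD formula CM elliptic curve at
the ramified prime elliptic units index" (8 docs, all textbooks: silverman2009 pp 398/415,
delbourgo2008 p16, coates1999 pp 70/215 — no ramified-prime formula); lit galaxy search "ramified
primes|elliptic units|anticyclotomic" --star all (8 hits, none relevant: lecture notes, ANT vol 13
front matter, Vasiu surjectivity); lean search 'RamifiedCMEllipticUnitIndexAt' (tree only: O11
files); ledger negatives --problem BirchSwinnertonDyer (no statement at a ramified CM prime).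
Nearest prior art found: [corpus:paper:arxiv-2608.06879 p.1] BurungaleKobayashiNakamuraOta2026
(anticyclotomic CM main conjecture AT RAMIFIED PRIMES, Thm 1.2; §1.4: no p-adic Gross–Zagier / BSD
formula there); [corpus:paper:arxiv-2508.17776 p.59] BKNO local sign decomposition (cites the
former); Rubin1991MainConj (two-variable main conjecture, elliptic units).
Delta: reads the `7`-part of BSD for the `ℚ(√−7)` class off Rubin's elliptic-unit INDEX at the
ramified prime plus two finite-level strict-Selmer statements, where print stops at the main
conjecture without a leading-term formula.
Claimed grade: new-combination  [refs: paper:arxiv-2608.06879, paper:arxiv-2508.17776, BurungaleKobayashiNakamuraOta2026]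

Barriers (technique_class: iwasawa-main-conjecture, elliptic-units, strict-control): - technique_class: iwasawa-main-conjecture, elliptic-units, strict-control
- Literature.Barriers.BirchSwinnertonDyer.ExceptionalZeroBarrier: outside — needs SPLIT MULT p; 7 is
ADDITIVE on 𝒞₇.
- Literature.Barriers.BirchSwinnertonDyer.ExceptionalZeroBarrierNarrow: outside — no MTT `L_p(E,T)`
used.
- Literature.Barriers.BirchSwinnertonDyer.PAdicHeightBarrier: outside — no p-adic height.
- Literature.Barriers.BirchSwinnertonDyer.PAdicHeightBarrierNarrow: outside — no ordinary
`L_p(f,α,T)`.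
- Literature.Barriers.BirchSwinnertonDyer.SelmerRankBarrier: discharged — rank = r_an, Ш finite
(GZK).
- Literature.Barriers.BirchSwinnertonDyer.AnticyclotomicHeightDegeneracy: outside — no height.
- Literature.Barriers.BirchSwinnertonDyer.HeegnerPointBarrier: other system (elliptic units), no
Heegner class at 7.
- Literature.Barriers.BirchSwinnertonDyer.EisensteinMuBarrier: outside by hypothesis — Prop 5.7
needs ordinary/mult p on the cyclotomic line; 7 is additive, towers anticyclotomic, Rubin IMC
μ-free. RIDER (J): 7 IS Eisenstein on 𝒞₇ (rational 7-isogeny); any cyclotomic-μ/GV import re-enters.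
- Literature.Barriers.BirchSwinnertonDyer.ReducibleAnticyclotomicAtBadP: outside class X2 (Mult ∧
Red) and its inputs (Heegner/BDP/BF); CM elliptic-unit IMC printed AT the bad CM prime (Rubin 1991
4.1(ii); BKNO §3); the value formula at 𝟙 there is NOT in print — it IS this route's open crux.
- Literature.Barriers.BirchSwinnertonDyer.AnomalousHeegnerLogWall: outside (`Anom` ⇒ good p).
Negatives: nil.

History (route lifecycle, newest last):
- 2026-08-26T13:32:49Z · AUTO-CRUX (edit): EllipticUnitIMCSeven — hypotheses of the deciding theorem that nothing in the route derives are cruxes (planner-bsd-cm-plan-g18-0)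
- 2026-08-26T14:39:15Z · AUTO-CRUX (edit): EllipticUnitIMCSeven — hypotheses of the deciding theorem that nothing in the route derives are cruxes (planner-bsd-cm-plan-g18-0)

sub-problem: BirchSwinnertonDyer · status: open · opened planner-bsd-cm-plan-g10-0 2026-08-25T21:13:34Z · rev 24 · ledger route-BirchSwinnertonDyer-RamifiedSevenEllipticUnits
GENERATED by the gate from the ledger (D-0016/17). Provers cite these decls: `theorem foo : Summit.BirchSwinnertonDyer.BirchSwinnertonDyer.Theses.RamifiedSevenEllipticUnits.<Decl> := …` in Summits/BirchSwinnertonDyer/BirchSwinnertonDyer/Theorems/<Name>.lean.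
-/

namespace Summit.BirchSwinnertonDyer.BirchSwinnertonDyer.Theses.RamifiedSevenEllipticUnits

open scoped BigOperators Topology Manifold Classical MeasureTheory ProbabilityTheory Matrix InnerProductSpace ComplexConjugate ContinuousMap
open Filter Set Function TopologicalSpace MeasureTheory

attribute [summit_statement] _root_.BirchSwinnertonDyer
attribute [summit_statement] _root_.Summit.BirchSwinnertonDyer.Rank1Residual.X12.CMRamifiedSeven

open Literature

/-- item stmt-BirchSwinnertonDyer-19945 · crux · rank 2 · open · by planner
why it might fail: (★_an) at a ramified prime is what an explicit reciprocity law / BDP-type formula at p | d_K would give and none is printed (AI 2024 n ≥ 2, Kriz 2021 p ∤ N, Fan–Wan n ≥ 2 exclude 𝒞₇); stub S_open (λ₀ = 2(n+n′) + ord₇Ш_an) may fail for a member (falsifier: β digit table, D = −79).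
sources: BurungaleKobayashiNakamuraOta2026, arXiv:2608.06879, Rubin1991MainConj, PerrinRiou1993AIF, GrossZagier1986, Kolyvagin1990
[crux · ATTACKED] the bottom-class VALUE formula (★_an) at 7 for each W ∈ 𝒞₇ over the 𝒪_𝔭-span
carrier: for every elliptic-unit class datum D with bottom index exponent c (HasBottomIndexExpZp)
satisfying the IMC identity, c = n + n′ + ord₇ #Ш_an(W) + ord₇ #Ш_an(W′) — under the published GZK
input (Ш finite in analytic rank ≤ 1) that the Selmer-saturation step (sat) of the Rubin-formula
line consumes (D117 (3); pattern StrictTorsionSevenOfGZK). Repairs 19705 (vacuous over the ℤ-span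
carrier). -/
@[route_item "route-BirchSwinnertonDyer-RamifiedSevenEllipticUnits", crux (experiment := "search: er offer 40dde4e595566955 of 22:01Z 08-31 pending placement); K2-J item 19357 v3 (bsd-addord, LEAD cruxlead-19357 g22). K7r CM ramified 7 (…") (source := "director BSD l.276, 2026-09-01")]
def EllipticUnitValueSevenOfGZK : Prop :=
  Literature.NumberTheory.EllipticCurves.rank_eq_analyticRank_of_analyticRank_le_one → ∀ (W : WeierstrassCurve ℚ) [W.IsElliptic] [W.IsGloballyMinimal] [Fact (Nat.Prime 7)], Summit.BirchSwinnertonDyer.Rank1Residual.X12.ClassCSeven W → Summit.BirchSwinnertonDyer.Rank1Residual.X12.O11.RamifiedCMBottomClassIndexLawAtZp W 7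

/-- item stmt-BirchSwinnertonDyer-19677 · crux · rank 3 · closed · proved by Summit.BirchSwinnertonDyer.BirchSwinnertonDyer.Theorems.strictTorsionSevenOfGZK_proof (prover) · by planner
why it might fail: It cannot: the closing term exists in the tree (`RamifiedSevenEllipticUnits.strictTorsionSeven_of_GZK`, p430232, axioms standard). The only content risk sits in the antecedent GZK, a published theorem (Gross–Zagier 1986 + Kolyvagin 1990) entering by name.
sources: GrossZagier1986, Kolyvagin1990, GreenbergLNM1716, Castella2018
[crux] the strict `7`-torsion clause (R-tors)@7 `O11.RamifiedCMStrictTorsionAt W 7` for every global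
minimal `W ∈ 𝒞₇` (the strict anticyclotomic Selmer dual `X = AcSelmer.XAc (W_K) 7 κ 𝔭 ∅ γ` is
torsion with `ord₇ f(0) = n₀` for some `n₀`, and `X[T]` finite, at every O11 frame of analytic rank
one) — GRANTED the named published fact GZK (`rank_eq_analyticRank_of_analyticRank_le_one`:
Gross–Zagier 1986 I.(7.3) + Kolyvagin 1990 Thm A; conjunct 7 of `PublishedFactsSeven`, so `closes`
feeds it `h₅.2.2.2.2.2.2.1` — no forward reference to the rank-9 support decl). This is the
conditional TWIN of `StrictTorsionSeven` (stmt-19144, to go `aside`): hands k7r-c3 g0/g2 and k7r-c4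
g2 proved in the kernel that the fact-free original is EQUIVALENT to «`Sel_str(W/ℚ)[7^∞]` finite for
every globally minimal `W ∈ 𝒞₇`»
(`RamifiedSevenEllipticUnits.strictTorsionSeven_iff_finite_strictSelmerPInfty`, p431290) — the
7-primary Kolyvagin finiteness on the INFINITE class 𝒞₇, which the tree holds only as the named fact
GZK — so no proof could close it as typed; and that GZK suffices
(`RamifiedSevenEllipticUnits.strictTorsionSeven_of_GZK` / `…_of_publishedFactsSeven`, p430232: in
analytic rank one no Euler sy -/
@[route_item "route-BirchSwinnertonDyer-RamifiedSevenEllipticUnits", crux]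
def StrictTorsionSevenOfGZK : Prop :=
  Literature.NumberTheory.EllipticCurves.rank_eq_analyticRank_of_analyticRank_le_one → ∀ (W : WeierstrassCurve ℚ) [W.IsElliptic] [W.IsGloballyMinimal] [Fact (Nat.Prime 7)], Summit.BirchSwinnertonDyer.Rank1Residual.X12.ClassCSeven W → Summit.BirchSwinnertonDyer.Rank1Residual.X12.O11.RamifiedCMStrictTorsionAt W 7

-- `StrictTorsionSevenOfGZK` holds: proved by `Summit.BirchSwinnertonDyer.BirchSwinnertonDyer.Theorems.strictTorsionSevenOfGZK_proof` (its module imports this route file, so no `_holds` link can be stated here).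

/-- item stmt-BirchSwinnertonDyer-19145 · crux · rank 4 · closed · proved by Summit.BirchSwinnertonDyer.BirchSwinnertonDyer.Theorems.RamifiedSevenEllipticUnits.StrictControlSeven_proof (prover) · by planner
why it might fail: control theorems at primes where the extension is totally ramified AND the curve has additive reduction need the local condition to be cofinitely generated with controlled universal norms; for additive reduction at 7 the universal-norm subgroup can be of infinite index (Greenberg LNM1716 §3 caveat).
sources: GreenbergLNM1716, AgboolaHoward2006, Castella2018, BurungaleKobayashiNakamuraOta2026
[crux] (R-ctrl)@7 on 𝒞₇ — strict anticyclotomic control `O11.RamifiedCMStrictControlAt W 7` for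
every global minimal `W` in 𝒞₇ (Mazur-type control for the strict Selmer group along the
anticyclotomic `ℤ_7`-extension of `ℚ(√−7)`, finite bounded kernel and cokernel at level 0).
[difficulty: L] -/
@[route_item "route-BirchSwinnertonDyer-RamifiedSevenEllipticUnits", crux]
def StrictControlSeven : Prop :=
  ∀ (W : WeierstrassCurve ℚ) [W.IsElliptic] [W.IsGloballyMinimal] [Fact (Nat.Prime 7)], Summit.BirchSwinnertonDyer.Rank1Residual.X12.ClassCSeven W → Summit.BirchSwinnertonDyer.Rank1Residual.X12.O11.RamifiedCMStrictControlAt W 7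

-- `StrictControlSeven` holds: proved by `Summit.BirchSwinnertonDyer.BirchSwinnertonDyer.Theorems.RamifiedSevenEllipticUnits.StrictControlSeven_proof` (its module imports this route file, so no `_holds` link can be stated here).

/-- item stmt-BirchSwinnertonDyer-19944 · crux (kind.auto-crux: conjecture-grade) · rank 9 · open · by planner
why it might fail: Open conjecture at a prime RAMIFIED in K: BKNO 2026 treat split/inert only, Rubin 1991 needs p ∤ #𝒪_K^× · h_K and the two-variable form; no printed measure whose range contains the bottom character.
sources: BurungaleKobayashiNakamuraOta2026, Rubin1991MainConj, JohnsonLeungKings2011, arXiv:2608.06879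
[support · RESIDUAL, conjecture-grade, PRE-printed] the anticyclotomic elliptic-unit main conjecture
at the ramified prime 7 for each W ∈ 𝒞₇, bottom-layer ∃-form over the 𝒪_𝔭-span carrier
`padicEndSpan` (D117 repair of 19704, whose ℤ-span carrier made the ∃-form unsatisfiable); sources
as 19704. -/
@[route_item "route-BirchSwinnertonDyer-RamifiedSevenEllipticUnits", crux]
def EllipticUnitIMCSevenZp : Prop :=
  ∀ (W : WeierstrassCurve ℚ) [W.IsElliptic] [W.IsGloballyMinimal] [Fact (Nat.Prime 7)], Summit.BirchSwinnertonDyer.Rank1Residual.X12.ClassCSeven W → Summit.BirchSwinnertonDyer.Rank1Residual.X12.O11.RamifiedCMEllipticUnitIMCAtZp W 7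

/-- item stmt-BirchSwinnertonDyer-19143 · aside · rank 2 · SPLIT (gen 1) into EllipticUnitIMCSeven, EllipticUnitValueSeven + glue EllipticUnitIndexSevenGlue · direct attempts still welcome (low priority) · by planner
why it might fail: As TYPED, modulo 19144 ∧ 19145 ∧ facts the crux ↔ BSD₇ on all of 𝒞₇ (k7r-c2 `ellipticUnitIndexSeven_iff_cmRamifiedSeven`): false iff BSD₇ fails at a member. Proof-route risk: Rubin's IMC at the totally ramified p = 7 = −d_K may lose a power of 7 in the index-to-L-value step; no (★_an) in print.
sources: Rubin1991MainConj, Rubin1987LocalUnits, BurungaleKobayashiNakamuraOta2026, arXiv:2608.06879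
[crux] (R-EU)@7 on 𝒞₇ — for every global minimal `W` in 𝒞₇, the ramified-prime elliptic-unit index
law `O11.RamifiedCMEllipticUnitIndexAt W 7` (Rubin's main conjecture over `K = ℚ(√−7)` specialised
to the character of `W` at the prime `𝔭 | 7`, as typed in `X12/O11/RamifiedStrictDescent.lean`).
[difficulty: XL] -/
@[route_item "route-BirchSwinnertonDyer-RamifiedSevenEllipticUnits", crux]
def EllipticUnitIndexSeven : Prop :=
  ∀ (W : WeierstrassCurve ℚ) [W.IsElliptic] [W.IsGloballyMinimal] [Fact (Nat.Prime 7)], Summit.BirchSwinnertonDyer.Rank1Residual.X12.ClassCSeven W → Summit.BirchSwinnertonDyer.Rank1Residual.X12.O11.RamifiedCMEllipticUnitIndexAt W 7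

-- parent: EllipticUnitIndexSeven · child (gen 1)
/--     item stmt-BirchSwinnertonDyer-19704 · aside (kind.auto-crux: conjecture-grade) · rank 201 · open
    parent: EllipticUnitIndexSeven · by planner
    why it might fail: BKNO Thm 3.14(3) is a 2026 PREPRINT at an additive prime; the T = 0 reading needs no finite Λ-submodule in X and exact bottom control for S_rel at the ramified 𝔭; a Λ → Λ^ac descent dropping a μ-type factor shifts n₀ + log #X[T] below the minimal bottom index and falsifies the ∃-form.
    sources: Rubin1991MainConj, JohnsonLeungKings2011, arXiv:0804.2828, arXiv:2608.06879, BurungaleKobayashiNakamuraOta2026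
[support, CITE-LEVEL — J checklist (2) «IMC piece», ∃-form after bsd-cm-ram g7's β module p441800
(BETA-DESIGN §3: junk-free pattern)] on 𝒞₇, at every framed O11 pair of analytic rank one and every
anticyclotomic ℤ₇-tower with generator: `X12.O11.RamifiedCMEllipticUnitIMCAt W 7` (stated ALONE; it
implies the existence statement (a) `X12.O11.RamifiedCMBottomClassExistsAt W 7` — SOME
anticyclotomic elliptic-unit class datum (ι, φ, Ω, 𝓔, D : EllipticUnitClassData W 7 K 𝔭 κ γ ι φ Ω 𝓔)
has a bottom index exponent c (D.HasBottomIndexExp c: z(𝟙) non-torsion of finite π-adic index in the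
bottom relaxed compact Selmer group; ⟸ the existence claim `RubinEllipticUnitClasses` (BKNO §3.3.1
(3.8)–(3.9), Rubin 1991 §§1–2, Kato §15.5) + BKNO Prop 3.7 (1) non-vanishing in rank one); (b)
`X12.O11.RamifiedCMEllipticUnitIMCAt W 7` — SOME such datum has an exponent c with, whenever the
strict anticyclotomic Selmer dual X has ord₇ f(0) = n₀ and finite X[T], n₀ + log₇ #X[T] = c (BKNO
Thm 3.14(3) Ch_{Λac}(S^ac_rel/Λ_ac·z^ac) = Ch_{Λac}(X^ac_str) — standing hypotheses §3.1.1: p ≥ 3, p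
∤ h_K, p non-split; Thm 3.14(3) hypotheses: Assumption 3.1 (vacuous (1) at p = 7; (2) with H = K for
ℚ(√−7)) and p ∤ #μ(H) -/
@[route_item "route-BirchSwinnertonDyer-RamifiedSevenEllipticUnits"]
def EllipticUnitIMCSeven : Prop :=
  ∀ (W : WeierstrassCurve ℚ) [W.IsElliptic] [W.IsGloballyMinimal] [Fact (Nat.Prime 7)], Summit.BirchSwinnertonDyer.Rank1Residual.X12.ClassCSeven W → Summit.BirchSwinnertonDyer.Rank1Residual.X12.O11.RamifiedCMEllipticUnitIMCAt W 7

-- parent: EllipticUnitIndexSeven · child (gen 1)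
/--     item stmt-BirchSwinnertonDyer-19705 · aside · rank 202 · open
    parent: EllipticUnitIndexSeven · by planner
    why it might fail: ≡ BSD₇ on the infinite class 𝒞₇ modulo printed IMC∃ (Rubin91 4.1(ii), BKNO 3.14(3)) + (R-tors): false iff 7 ∣ #Ш/#Ш_an at some member. As a PROOF target it needs the unprinted ramified Rubin/BDP value formula (★_an)♯ (C_𝔭; BKNO §1.4): the δ-line stub S_open may be mis-shaped though the crux holds.
    sources: arXiv:2608.06879, BurungaleKobayashiNakamuraOta2026, Rubin1991MainConj, PerrinRiou1993AIF, BG85, doi:10.1017/s147474802300021x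
[crux, ATTACKED — J 2026-08-26T07:36:48Z checklist (2) «value piece», RELATIVE form after bsd-cm-ram
g7's β module p441800 and junk analysis BETA-DESIGN §2–§3] (★_an)@7 = Perrin-Riou's law for the
bottom elliptic-unit class at the RAMIFIED prime, RELATIVE to the main-conjecture identity, on 𝒞₇:
for every framed O11 pair (W, W' = W^(−7)) of analytic rank one, every anticyclotomic ℤ₇-tower κ of
K = ℚ(√−7) with generator γ, generators P, P' of levels n, n' and #Ш_an = q, q', and for EVERY
anticyclotomic elliptic-unit class datum D : EllipticUnitClassData W 7 K 𝔭 κ γ ι φ Ω 𝓔 (BKNO 2026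
§3.3.1 class over the dual-exponential datum 𝓔, period Ω, Hecke character φ;
Literature/…/BurungaleKobayashiNakamuraOta2026/AnticyclotomicEllipticUnitClass.lean) and every
exponent c with D.HasBottomIndexExp c (p^c = [S_{p,rel}(E/K) : tors + 𝒪_K·z(𝟙)]) WHICH SATISFIES the
IMC identity n₀ + log₇ #X[T] = c (shared binder c): c = n + n' + ord₇ q + ord₇ q'. Junk data
(rescaled 𝓔, BETA-DESIGN §2 `scaleByP`) fail the IMC hypothesis and satisfy the law vacuously; on
BKNO's integrally normalised class it is exactly (★_an) — what an explicit reciprocity law /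
BDP-type formula at the ramified prime proves (BKNO Th -/
@[route_item "route-BirchSwinnertonDyer-RamifiedSevenEllipticUnits"]
def EllipticUnitValueSeven : Prop :=
  ∀ (W : WeierstrassCurve ℚ) [W.IsElliptic] [W.IsGloballyMinimal] [Fact (Nat.Prime 7)], Summit.BirchSwinnertonDyer.Rank1Residual.X12.ClassCSeven W → Summit.BirchSwinnertonDyer.Rank1Residual.X12.O11.RamifiedCMBottomClassIndexLawAt W 7

-- parent: EllipticUnitIndexSeven · glue (gen 1)
/--     item stmt-BirchSwinnertonDyer-19706 · aside · rank 203 · closed · proved by Summit.BirchSwinnertonDyer.BirchSwinnertonDyer.Theorems.ramifiedSevenEllipticUnits_ellipticUnitIndexSevenGlue_proof (prover)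
    parent: EllipticUnitIndexSeven · GLUE: children ⟹ parent · by planner
IMC piece ∧ VALUE piece ⟹ (R-EU)@7 on 𝒞₇ (= the body of EllipticUnitIndexSeven): closes AT ONCE by
the landed Theses-free bridge seam
Summit.BirchSwinnertonDyer.BirchSwinnertonDyer.Rank1Residual.EllipticUnitMechanismBridge.ellipticUnitIndexAt_seven_of_imc_of_value
(p447575, k7r-c4 g4; argument order IMC, Value — permute the binders to the rendered order), over
the O11 seam X12.O11.ramifiedCMEllipticUnitIndexAt_of_imc_of_indexLaw (p447314). Trivial by design
(BRIDGE split, trivial_seam declared): the content sits in the two children, neither of which gives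
(R-EU)@7 or the leaf alone (k7r-c4 PROBES, evidence #39 on 19143: BC2 4/4 FAIL, BC7 2/2 CLEAN). -/
@[route_item "route-BirchSwinnertonDyer-RamifiedSevenEllipticUnits"]
def EllipticUnitIndexSevenGlue : Prop :=
  EllipticUnitIMCSeven → EllipticUnitValueSeven → EllipticUnitIndexSeven

-- `EllipticUnitIndexSevenGlue` holds: proved by `Summit.BirchSwinnertonDyer.BirchSwinnertonDyer.Theorems.ramifiedSevenEllipticUnits_ellipticUnitIndexSevenGlue_proof` (its module imports this route file, so no `_holds` link can be stated here).

/-- item stmt-BirchSwinnertonDyer-19144 · aside · rank 3 · open · by planner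
why it might fail: at the ramified prime the formal group of `W/ℚ_7` has height-one reduction only after the totally ramified twist; `E(K_𝔭)[7] = 0` holds for 𝒞₇ members but the STRICT module over the tower may acquire 7-torsion from the norm-incompatibility of local points (no Perrin-Riou basis at ramified p).
sources: AgboolaHoward2006, Rubin1987LocalUnits, BurungaleKobayashiOta2021, arXiv:2508.17776
[crux] (R-tors)@7 on 𝒞₇ — strict `7`-torsion vanishing `O11.RamifiedCMStrictTorsionAt W 7` for every
global minimal `W` in 𝒞₇ (no `7`-torsion in the relevant strict Selmer module over the
anticyclotomic tower at the ramified prime). [difficulty: L] -/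
@[route_item "route-BirchSwinnertonDyer-RamifiedSevenEllipticUnits"]
def StrictTorsionSeven : Prop :=
  ∀ (W : WeierstrassCurve ℚ) [W.IsElliptic] [W.IsGloballyMinimal] [Fact (Nat.Prime 7)], Summit.BirchSwinnertonDyer.Rank1Residual.X12.ClassCSeven W → Summit.BirchSwinnertonDyer.Rank1Residual.X12.O11.RamifiedCMStrictTorsionAt W 7

/-- item stmt-BirchSwinnertonDyer-19122 · support · rank 9 · closed · proved by Summit.BirchSwinnertonDyer.BirchSwinnertonDyer.Theorems.frameDataSevenOfGZK_proof (prover) · by planner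
sources: Miller2011LMS, SilvermanATAEC1994, BurungaleKobayashiNakamuraOta2026, GrossZagier1986, Kolyvagin1990
[support] D75 (planner g12): the frame data at 7 for each `W ∈ 𝒞₇` — CM field `K` with the prime `𝔭
∋ 7`, an isogenous global-minimal twin `W'` with its frame `O11.IsFrame W 7 K 𝔭 W' C`, an
anticyclotomic `ℤ_7`-extension with a topological generator, and for `W` and `W'` a generator `P` of
`E(ℚ)/tors` with its exact `7`-divisibility level in `E(ℚ_7)` and `E(ℚ_7)[7] = 0` — CONDITIONAL on
the named Literature fact GZK (`rank_eq_analyticRank_of_analyticRank_le_one`, already a conjunct of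
`PublishedFactsSeven`). This is the closable twin of `FrameDataSeven` (stmt-19146, now `aside`): ram
g5 (STATUS 22:22:17Z) — anticyclotomic ℤ_7-extension = `ZpExtension.exists_isAnticyclotomic_holds`
(unconditional in the tree), Mordell–Weil = `module_finite_point_holds` +
`StrictSha.exists_generator_of_mordellWeilRank_eq_one`, levels =
`exists_level_of_not_isOfFinAddOrder`, `E(ℚ_7)[7] = 0` = Mazur's local step (v₇(c₆) ≡ 2 (mod 3)
forced by j ∈ {−3375, 255³}); the ONLY input the closed statement cannot supply is `mordellWeilRank
W = 1`, i.e. GZK at analytic rank one. The deciding theorem feeds this item with the GZK conjunct of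
`PublishedFactsSeven`. Closes by name: `theorem … : FrameDataSevenOfGZK := -/
@[route_item "route-BirchSwinnertonDyer-RamifiedSevenEllipticUnits", crux]
def FrameDataSevenOfGZK : Prop :=
  Literature.NumberTheory.EllipticCurves.rank_eq_analyticRank_of_analyticRank_le_one → ∀ (W : WeierstrassCurve ℚ) [W.IsElliptic] [W.IsGloballyMinimal] [Fact (Nat.Prime 7)], Summit.BirchSwinnertonDyer.Rank1Residual.X12.ClassCSeven W → ∃ (K : Type) (_ : Field K) (_ : NumberField K) (𝔭 : IsDedekindDomain.HeightOneSpectrum (NumberField.RingOfIntegers K)) (W' : WeierstrassCurve ℚ) (_ : W'.IsElliptic) (_ : W'.IsGloballyMinimal) (C : WeierstrassCurve.VariableChange ℚ) (κ : Literature.NumberTheory.EllipticCurves.ZpExtension K 7) (γ : Field.absoluteGaloisGroup K) (_ : Fact (κ.IsTopGenerator γ)) (P : W.toAffine.Point) (n : ℕ) (P' : W'.toAffine.Point) (n' : ℕ), Summit.BirchSwinnertonDyer.Rank1Residual.X12.O11.IsFrame W 7 K 𝔭 W' C ∧ WeierstrassCurve.IsIsogenous W W' ∧ κ.IsAnticyclotomic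 ∧ ¬ IsOfFinAddOrder P ∧ (∀ R : W.toAffine.Point, ∃ (k : ℤ) (T : W.toAffine.Point), IsOfFinAddOrder T ∧ R = k • P + T) ∧ (∀ Q : (W.baseChange ℚ_[7]).toAffine.Point, 7 • Q = 0 → Q = 0) ∧ (∃ Q : (W.baseChange ℚ_[7]).toAffine.Point, 7 ^ n • Q = W.toPadicPoint 7 P) ∧ (∀ Q : (W.baseChange ℚ_[7]).toAffine.Point, 7 ^ (n + 1) • Q ≠ W.toPadicPoint 7 P) ∧ ¬ IsOfFinAddOrder P' ∧ (∀ R : W'.toAffine.Point, ∃ (k : ℤ) (T : W'.toAffine.Point), IsOfFinAddOrder T ∧ R = k • P' + T) ∧ (∀ Q : (W'.baseChange ℚ_[7]).toAffine.Point, 7 • Q = 0 → Q = 0) ∧ (∃ Q : (W'.baseChange ℚ_[7]).toAffine.Point, 7 ^ n' • Q = W'.toPadicPoint 7 P') ∧ (∀ Q : (W'.baseChange ℚ_[7]).toAffine.Point, 7 ^ (n' + 1) • Q ≠ W'.toPadicPoint 7 P')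

-- `FrameDataSevenOfGZK` holds: proved by `Summit.BirchSwinnertonDyer.BirchSwinnertonDyer.Theorems.frameDataSevenOfGZK_proof` (its module imports this route file, so no `_holds` link can be stated here).

/-- item stmt-BirchSwinnertonDyer-19141 · aside · rank 9 · open · by operator
sources: LiTianYanZhu2025, Literature.NumberTheory.EllipticCurves.LiTianYanZhu2025.CMRankOnePPart
[support, PRINTED — closes only by formalising the source; carried as a hypothesis exactly like
PublishedFactsAllTwists] Li–Tian–Yan–Zhu 2025 (PAMQ 21, doi:10.4310/pamq.251115004959) Thm. 1.1: the
p-part of the BSD formula for CM elliptic curves E/ℚ of analytic rank 1 at every prime p (p split in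
K if p ≠ 2; good ordinary at p if p = 2) — the tree's cite-tagged Literature Prop, by name. It is
the GOOD cell of the parent twin (tree theorem bsdTwo_cmSplit_goodCell_of_thm11, file 13). -/
@[route_item "route-BirchSwinnertonDyer-RamifiedSevenEllipticUnits"]
def LTYZThm11CMRankOnePPart : Prop :=
  Literature.NumberTheory.EllipticCurves.LiTianYanZhu2025.thm11_bsdp_of_cm_rank_one

/-- item stmt-BirchSwinnertonDyer-19146 · aside · rank 9 · open · by planner
sources: Miller2011LMS, SilvermanATAEC1994, BurungaleKobayashiNakamuraOta2026
[support] frame data at 7 for each `W ∈ 𝒞₇` — the CM field `K` with the prime `𝔭 ∋ 7`, an isogenous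
global-minimal twin `W'` with its frame `O11.IsFrame W 7 K 𝔭 W' C`, an anticyclotomic
`ℤ_7`-extension with a topological generator, and for `W` and `W'` a generator `P` of `E(ℚ)/tors`
with its exact `7`-divisibility level `n` in `E(ℚ_7)` and `E(ℚ_7)[7] = 0`; provable now
member-by-member from the class list (26 curves) — bookkeeping, not a crux. [difficulty:
provable-now] -/
@[route_item "route-BirchSwinnertonDyer-RamifiedSevenEllipticUnits"]
def FrameDataSeven : Prop :=
  ∀ (W : WeierstrassCurve ℚ) [W.IsElliptic] [W.IsGloballyMinimal] [Fact (Nat.Prime 7)], Summit.BirchSwinnertonDyer.Rank1Residual.X12.ClassCSeven W → ∃ (K : Type) (_ : Field K) (_ : NumberField K) (𝔭 : IsDedekindDomain.HeightOneSpectrum (NumberField.RingOfIntegers K)) (W' : WeierstrassCurve ℚ) (_ : W'.IsElliptic) (_ : W'.IsGloballyMinimal) (C : WeierstrassCurve.VariableChange ℚ) (κ : Literature.NumberTheory.EllipticCurves.ZpExtension K 7) (γ : Field.absoluteGaloisGroup K) (_ : Fact (κ.IsTopGenerator γ)) (P : W.toAffine.Point) (n : ℕ) (P' : W'.toAffine.Point)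 (n' : ℕ), Summit.BirchSwinnertonDyer.Rank1Residual.X12.O11.IsFrame W 7 K 𝔭 W' C ∧ WeierstrassCurve.IsIsogenous W W' ∧ κ.IsAnticyclotomic ∧ ¬ IsOfFinAddOrder P ∧ (∀ R : W.toAffine.Point, ∃ (k : ℤ) (T : W.toAffine.Point), IsOfFinAddOrder T ∧ R = k • P + T) ∧ (∀ Q : (W.baseChange ℚ_[7]).toAffine.Point, 7 • Q = 0 → Q = 0) ∧ (∃ Q : (W.baseChange ℚ_[7]).toAffine.Point, 7 ^ n • Q = W.toPadicPoint 7 P) ∧ (∀ Q : (W.baseChange ℚ_[7]).toAffine.Point, 7 ^ (n + 1) • Q ≠ W.toPadicPoint 7 P) ∧ ¬ IsOfFinAddOrder P' ∧ (∀ R : W'.toAffine.Point, ∃ (k : ℤ) (T : W'.toAffine.Point), IsOfFinAddOrder T ∧ R = k • P' + T) ∧ (∀ Q : (W'.baseChange ℚ_[7]).toAffine.Point, 7 • Q = 0 → Q = 0) ∧ (∃ Q : (W'.baseChange ℚ_[7]).toAffine.Point, 7 ^ n' • Q = W'.toPadicPoint 7 P') ∧ (∀ Q : (W'.baseChange ℚ_[7]).toAffine.Point,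 7 ^ (n' + 1) • Q ≠ W'.toPadicPoint 7 P')

/-- item stmt-BirchSwinnertonDyer-19147 · support · rank 9 · open · by planner
sources: LiLiuTian2024, Kobayashi2013, LiTianYanZhu2025, GrossZagier1986, Cassels1965ArithmeticVIII, BurungaleFlach2024
[support] the published named facts the consumer takes as hypotheses, as ONE conjunction:
Rubin/Coates–Wiles rank-0 CM BSD triple, entire continuation of `L(E,s)`, LLT24 Thm 1.1, Kob13 Cor
1.4, LTYZ25 Thm 1.1 (BSD(E,p) for CM rank one at the NON-ramified primes), Gross–Zagier I.7.3, GZK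
rank ≤ 1 ⇒ rank = analytic rank and Ш finite, Cassels isogeny invariance of the BSD quotient — each
a cite-tagged `def … : Prop` of Literature, discharged by `(h : X)`. [difficulty: provable-now] -/
@[route_item "route-BirchSwinnertonDyer-RamifiedSevenEllipticUnits", crux]
def PublishedFactsSeven : Prop :=
  Literature.NumberTheory.EllipticCurves.bsdTriple_of_hasCM_of_L_one_ne_zero ∧ WeierstrassCurve.hasEntireLFunction_rat ∧ Literature.NumberTheory.EllipticCurves.LiLiuTian2024.thm11_bsdp_of_cm_rank_one ∧ Literature.NumberTheory.EllipticCurves.Kobayashi2013.cor14_bsdp_of_cm_rank_one ∧ Literature.NumberTheory.EllipticCurves.LiTianYanZhu2025.thm11_bsdp_of_cm_rank_one ∧ Literature.NumberTheory.EllipticCurves.GrossZagier1986_thm_I_7_3 ∧ Literature.NumberTheory.EllipticCurves.rank_eq_analyticRank_of_analyticRank_le_one ∧ WeierstrassCurve.bsdRHS_eq_of_isIsogenous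

/-- item stmt-BirchSwinnertonDyer-19273 · aside · rank 9 · open · by planner
sources: BreuilConradDiamondTaylor2001, Literature.NumberTheory.EllipticCurves.AnalyticRank
[support] entire continuation of L(E/ℚ, s) (modularity: Breuil–Conrad–Diamond–Taylor 2001 Thm A +
Hecke/Shimura), BY NAME — conjunct of MultConversePublishedInputsAtTwo (19185); same content, filed
so the head constant is item-stated (#15c one rule; cite_only dep) -/
@[route_item "route-BirchSwinnertonDyer-RamifiedSevenEllipticUnits"]
def EntireLFunctionRat : Prop :=
  WeierstrassCurve.hasEntireLFunction_rat

/-- item stmt-BirchSwinnertonDyer-19307 · aside · rank 9 · open · by operator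
sources: Cassels1965ArithmeticVIII, MilneADT2006, Literature.NumberTheory.EllipticCurves.BSDQuadraticDescent
[support] Cassels 1965 (Arithmetic on curves of genus 1, VIII; J. reine angew. Math. 217) / Milne
ADT Thm I.7.3 and Rem I.7.4: the BSD quotient (right-hand side of the BSD formula) is invariant
under isogeny over ℚ — conjunct of the support PrintedFacts (stmt-BirchSwinnertonDyer-19362), BY
NAME; same content, filed as a split child so the head constant is item-stated (gate5 #15c one rule;
readiness rule 2026-08-15: cite_only dep declared by the route; director-bsd 2026-08-26T04:22Z
«K3/E2 shape»); no crux statement / closes / tribunal change -/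
@[route_item "route-BirchSwinnertonDyer-RamifiedSevenEllipticUnits"]
def BSDQuotientIsogenyInvariance : Prop :=
  WeierstrassCurve.bsdRHS_eq_of_isIsogenous

/-- item stmt-BirchSwinnertonDyer-19369 · aside · rank 9 · open · by planner
sources: GrossZagier1986, Literature.NumberTheory.EllipticCurves.GrossZagierRationalPoint
[aside] Gross–Zagier 1986 Thm. I.(7.3) (p. 231; proof V.§2 pp. 310–313): L′(E,1) ≠ 0 ⇒ a rational
point of infinite order (via a Heegner point and the GZ formula) — a cite_only dep of this route
reached through the depth-1 support item PublishedInputsIMCReduction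
(stmt-BirchSwinnertonDyer-19283, child of 19061; a third item layer is forbidden, so it is
item-stated here as a by-name ASIDE: banked context, never staffed, BC6-exempt; gate5 02:15:40Z
«aside also counts»); no crux statement / closes / tribunal change -/
@[route_item "route-BirchSwinnertonDyer-RamifiedSevenEllipticUnits"]
def GrossZagierRationalPointI73 : Prop :=
  Literature.NumberTheory.EllipticCurves.GrossZagier1986_thm_I_7_3

/-- item stmt-BirchSwinnertonDyer-19423 · aside · rank 9 · open · by planner
sources: Rubin1991MainConj, BurungaleFlach2024, Literature.NumberTheory.EllipticCurves.ComplexMultiplication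
[support, cite-level BY-NAME ALIAS of a published input — never a prover target; held]
Burungale–Flach 2024 Thm. 1.1 + Cor. 2 (with Rubin 1991 Thm. 12.3 at p ∤ #O_K^×): the full BSD
formula for CM elliptic curves over ℚ with L(E,1) ≠ 0 at EVERY prime p. Conjunct 2 of
`PublishedInputsFineSelmerCM` (stmt 19387; closes the CM rows of the U₀-ns child); filed under this
split ONLY to item-state the constant (unused by the glue). -/
@[route_item "route-BirchSwinnertonDyer-RamifiedSevenEllipticUnits"]
def PublishedInputCMRankZeroBSD : Prop :=
  Literature.NumberTheory.EllipticCurves.bsdTriple_of_hasCM_of_L_one_ne_zero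

/-- item stmt-BirchSwinnertonDyer-19569 · aside · rank 9 · open · by planner
sources: LiLiuTian2024, Literature.NumberTheory.EllipticCurves.LiLiuTian2024.CMRankOnePPart
[aside] Li–Liu–Tian 2024 Thm 1.1: the p-part of BSD for CM E/ℚ of analytic rank 1 at the primes it
covers (`LiLiuTian2024.thm11_bsdp_of_cm_rank_one`; used by the consumer only for r_an = 1 ⇒
finiteness bookkeeping) — conjunct 4 of PublishedFactsTwo (19231), BY NAME. Banked context (D-0019
aside): never staffed, not progress, BC6-exempt; filed ONLY so the cite_only head constant is
item-stated (gate5 #15c one rule; staffable remedy). -/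
@[route_item "route-BirchSwinnertonDyer-RamifiedSevenEllipticUnits"]
def LiLiuTianCMRankOnePPart : Prop :=
  Literature.NumberTheory.EllipticCurves.LiLiuTian2024.thm11_bsdp_of_cm_rank_one

/-- item stmt-BirchSwinnertonDyer-19570 · aside · rank 9 · open · by planner
sources: Kobayashi2013, Literature.NumberTheory.EllipticCurves.Kobayashi2013.CMRankOnePPart
[aside] Kobayashi 2013 (Invent. Math. 191) Cor 1.4: the p-part of BSD for CM E/ℚ of analytic rank 1
at good p ∤ 2N (`Kobayashi2013.cor14_bsdp_of_cm_rank_one`; finiteness bookkeeping only) — conjunct 5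
of PublishedFactsTwo (19231), BY NAME. Banked context (D-0019 aside): never staffed, not progress,
BC6-exempt; filed ONLY so the cite_only head constant is item-stated (gate5 #15c one rule; staffable
remedy). -/
@[route_item "route-BirchSwinnertonDyer-RamifiedSevenEllipticUnits"]
def KobayashiCMRankOnePPart : Prop :=
  Literature.NumberTheory.EllipticCurves.Kobayashi2013.cor14_bsdp_of_cm_rank_one

/-- item stmt-BirchSwinnertonDyer-19921 · aside · rank 9 · open · by operator
sources: GrossZagier1986, Kolyvagin1990, Literature.NumberTheory.EllipticCurves.LeadingTerm
[support] The one PUBLISHED input the halves-glue consumes: Gross–Zagier–Kolyvagin, rank = analytic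
rank for analytic rank ≤ 1 with Ш finite (tree named fact
rank_eq_analyticRank_of_analyticRank_le_one; used by bsdp_of_missingPPartAt to turn Miller's last
clause into BSD(E,2)). Carried as a displayed PUB hypothesis; never counted as progress. The further
PRINT of the roads to the two halves (Greenberg Thm-4.1 analogues at a multiplicative prime
thm41Analogue_charValue_rankZero_numberField_anyPrime / …_split_baseChange_anyPrime, modularity) and
the referee-passed MEMO inputs (Kato ⊗ℚ at a multiplicative 2:
X5.O1.KatoMultiplicativeDivisibilityRat W 2, HOME mult/PROOF-MULT.md RC-2; Greenberg–Stevens at 2: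
greenberg_stevens W 2, mult/PROOF-GS2.md RC-4) enter the LINES under the halves (bridge
multiplicativeRankZeroAtTwo_of_muRoad, p409679), not this glue. -/
@[route_item "route-BirchSwinnertonDyer-RamifiedSevenEllipticUnits"]
def RankEqAnalyticRankLeOne : Prop :=
  Literature.NumberTheory.EllipticCurves.rank_eq_analyticRank_of_analyticRank_le_one

/-- item stmt-BirchSwinnertonDyer-19148 · assembly · rank 1 · closed · proved by Summit.BirchSwinnertonDyer.BirchSwinnertonDyer.Theorems.ramifiedSevenEllipticUnits_assembly_proof @ 5452e47c8128 (prover) · by planner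
sources: BurungaleKobayashiNakamuraOta2026, Rubin1991MainConj
[assembly] EllipticUnitIndexSeven → StrictTorsionSeven → StrictControlSeven → FrameDataSeven →
PublishedFactsSeven → X12.CMRamifiedSeven (the rung leaf K7r). -/
@[route_item "route-BirchSwinnertonDyer-RamifiedSevenEllipticUnits"]
def Assembly : Prop :=
  EllipticUnitIndexSeven → StrictTorsionSeven → StrictControlSeven → FrameDataSeven → PublishedFactsSeven → Summit.BirchSwinnertonDyer.Rank1Residual.X12.CMRamifiedSeven

-- `Assembly` holds: proved by `Summit.BirchSwinnertonDyer.BirchSwinnertonDyer.Theorems.ramifiedSevenEllipticUnits_assembly_proof` @ 5452e47c8128 (its module imports this route file, so no `_holds` link can be stated here).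

/-! D-0027 §2.1 — DECIDING THEOREM (planner-authored via `route open/edit --closes-file`; by planner-bsd-cm-plan-g19-0 2026-08-26T21:41:06Z):
its hypotheses are this route's items and its conclusion the registered leaf `Summit.BirchSwinnertonDyer.Rank1Residual.X12.CMRamifiedSeven` (rung K7r, D-0061) (glue_lint), and it elaborates with this file. -/

-- E-Zp closes (D117). Bridge: EllipticUnitMechanismBridgeZp.ellipticUnitIndexAt_seven_of_imcZp_of_valueZp (k7r-c4): IMC-Zp → Value-Zp → (R-EU)@7 on 𝒞₇, class level.
@[closes "route-BirchSwinnertonDyer-RamifiedSevenEllipticUnits"] theorem closes (h₁ : EllipticUnitIMCSevenZp) (h₂ : EllipticUnitValueSevenOfGZK) (h₃ : StrictTorsionSevenOfGZK)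
    (h₄ : StrictControlSeven) (h₅ : FrameDataSevenOfGZK) (h₆ : PublishedFactsSeven) :
    Summit.BirchSwinnertonDyer.Rank1Residual.X12.CMRamifiedSeven :=
  Summit.BirchSwinnertonDyer.BirchSwinnertonDyer.Rank1Residual.CMRungInputs.cmRamifiedSeven_of_inputs
    (Summit.BirchSwinnertonDyer.BirchSwinnertonDyer.Rank1Residual.EllipticUnitMechanismBridgeZp.ellipticUnitIndexAt_seven_of_imcZp_of_valueZp
      h₁ (h₂ h₆.2.2.2.2.2.2.1))
    (h₃ h₆.2.2.2.2.2.2.1) h₄ (h₅ h₆.2.2.2.2.2.2.1) h₆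

end Summit.BirchSwinnertonDyer.BirchSwinnertonDyer.Theses.RamifiedSevenEllipticUnits
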